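import Literature.NumberTheory.Automorphic.LocalConstants
import HarnessLib

/-!
# Deligne's local constants for THE Artin maps of class field theory (named fact)

Topic `Literature/NumberTheory/Automorphic`, companion of `LocalConstants`: the hypothesis structure
`Literature.NumberTheory.Automorphic.LocalEpsilonSystem F` (Deligne's system of local constants
`ε₀(ρ, ψ, dx)` over a non-archimedean local field `F`, which carries as DATA the local Artin data
`artin E : LocalArtinData E` of every finite extension `E/F` against which it is normalised — the
axioms `dim_one` and `addChar_shift`) and its named facts
`nonempty_localEpsilonSystem F := Nonempty (LocalEpsilonSystem F)` (existence) and
`localEpsilonSystem_unique` (uniqueness for two systems with the same Artin data).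

Deligne (*Les constantes des équations fonctionnelles des fonctions `L`*, Antwerp II, LNM 349
(1973), Thm. 4.1: existence and uniqueness of `ε(V, ψ, dx)` subject to (4.1.1) multiplicativity,
(4.1.2) `ε(χ ∘ artin, ψ, dx) = ε(χ, ψ, dx)` — Tate's local constant — in dimension one, (4.1.3)
inductivity in degree `0`; Thm. 6.5: the local proof), Langlands (*On the functional equation of
the Artin `L`-functions*, unpublished, 1970), Tate (*Number theoretic background*, Corvallis 1979,
(3.4.1)) and Bushnell–Henniart (*The local Langlands conjecture for `GL(2)`* (2006), §29.4
Theorem) construct the local constants with the dimension-one normalisation taken against the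
reciprocity maps of LOCAL CLASS FIELD THEORY, in the convention of Deligne §2.3 (uniformiser ↔
geometric Frobenius) — the convention of the tree's `LocalArtinData` (`artin_frob`).  In the tree
THE Artin map of `E` is the pinned `Literature.NumberTheory.GaloisRepresentations.canonicalArtin E`
(`LocalClassFieldTheory`: it has the characterising clauses `IsLocalArtinMap` by
`isLocalArtinMap_canonicalArtin` under `exists_isLocalArtinMap E`, and is every map with the clauses
under `IsLocalArtinMap.unique E`; both facts are discharged in the tree), and a datum
`d : LocalArtinData E` is normalised against it iff `d.IsCanonical :⇔ d.artin = canonicalArtin E`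
(a canonical datum: `LocalArtinData.ofExistsIsLocalArtinMap`).

The named fact `nonempty_localEpsilonSystem F` only records `Nonempty (LocalEpsilonSystem F)`: its
docstring says the witness is Deligne's system for the canonical Artin maps, but the `Prop` FORGETS
which Artin data the witness is normalised against.  This file records the printed theorem with the
normalisation retained, and two one-line consequences:

* `nonempty_localEpsilonSystem_isCanonical F` (named fact, `def … : Prop`, D-0014): there is a
  system of local constants `𝓔` over `F` with `(𝓔.artin E).IsCanonical` for EVERY finite extension
  `E/F` — Deligne 1973, Thm. 4.1 and Thm. 6.5, for the Artin maps of class field theory;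
* `nonempty_localEpsilonSystem_of_isCanonical` — it implies `nonempty_localEpsilonSystem F`
  (forget the normalisation);
* `exists_isCanonical_artin_self` — in particular `∃ 𝓔, (𝓔.artin F).IsCanonical` (`E := F`).

## Consumer (prose only; a Literature file imports no `Summits.*`)

The summit `Langlands` quantifies over reciprocity data `Summit.Langlands.ReciprocityData K` whose
local Langlands data are pinned to THE Artin maps (fields `llc_isCanonical`, `llc_eps_isCanonical`);
its non-vacuity conjunct `Nonempty (Summit.Langlands.ReciprocityData K)` is reduced by
`Summit.Langlands.Langlands.Theorems.ReciprocityUpToIrreducibilityR.stub_nonempty_of_inputs` (route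
`IrreducibilityBySelfDuality`, item `ReciprocityUpToIrreducibilityR`) to the present fact, taken at
every completion `K_v`, and the local Langlands correspondence `localLanglands_gl`.

## Design notes

* The statement is the body of `nonempty_localEpsilonSystem` with `Nonempty` opened to `∃` and the
  conjunct `∀ E, (𝓔.artin E).IsCanonical` added.  The binders of `E` are those of the field
  `LocalEpsilonSystem.artin` verbatim (`E : Type` with its own local-field instances and
  `[Algebra F E] [FiniteDimensional F E]`); as there, no compatibility of the `F`-algebra structure
  with the topology of `E` is imposed — harmless, since `IsCanonical` only refers to `E`'s own pinned
  map and Deligne's `ε(V, ψ, dx)` only to the local field `E` carrying `V`.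
* The content of the fact is not the existence of canonical Artin data (that is
  `LocalArtinData.ofExistsIsLocalArtinMap` with `exists_isLocalArtinMap`) but that Deligne's `ε₀`
  satisfies the axioms of `LocalEpsilonSystem` relative to THESE data, i.e. (4.1.2) and (5.4) for
  the reciprocity maps of class field theory at every finite extension simultaneously.
* Two canonical witnesses have the same Artin MAP at every `E`
  (`LocalArtinData.IsCanonical.artin_eq`), hence, under `localEpsilonSystem_unique` (stated for
  equal Artin DATA, which then holds by proof irrelevance of the remaining fields), the same `ε₀`.
* NOT here: the discharge `nonempty_localEpsilonSystem_isCanonical_holds` (Deligne's construction: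
  Tate's local constants in dimension one, Brauer induction, the local proof of §6 — the
  literature-prover's debt), and any `Summits`-side packaging.

## References

* P. Deligne, *Les constantes des équations fonctionnelles des fonctions L*, in *Modular Functions
  of One Variable II*, LNM 349 (1973), 501–597: §2.3, §4 Thm. 4.1, (4.1.2), (5.4), §6 Thm. 6.5.
  [Deligne1973Constantes]
* J. Tate, *Number theoretic background*, Proc. Sympos. Pure Math. 33 (1979), part 2, 3–26:
  (3.4.1)–(3.4.4). [TateCorvallis1979]
* C. J. Bushnell, G. Henniart, *The local Langlands conjecture for GL(2)*, Grundlehren 335 (2006),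
  §29.4 Theorem. [BushnellHenniart2006]
* R. P. Langlands, *On the functional equation of the Artin L-functions*, unpublished notes (1970).
-/

namespace Literature.NumberTheory.Automorphic

/-- **Existence of Deligne's local constants normalised against THE local Artin maps** (named
fact, D-0014).  For a non-archimedean local field `F` there is a system of local constants
`𝓔 : LocalEpsilonSystem F` — numbers `ε₀(E, ψ, μ, (ρ, N)) ∈ ℂ` for every finite extension `E/F`,
non-zero, isomorphism invariant, depending on `ρ` only, multiplicative in short exact sequences,
inductive in degree zero, with Deligne's scaling rules in `μ` and `ψ` — whose local Artin data
`𝓔.artin E`, against which the dimension-one normalisation `ε₀(χ ∘ artin_E, ψ, μ) = ε(0, χ, ψ, μ)`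
(Tate's local constant; axiom `dim_one`) and the rule `addChar_shift` are stated, are THE CANONICAL
ones at every finite extension `E/F`: `(𝓔.artin E).IsCanonical`, i.e.
`(𝓔.artin E).artin = canonicalArtin E`, the Artin map of local class field theory of `E` in
Deligne's convention (uniformiser ↔ geometric Frobenius).  This is Deligne's existence theorem as
printed — Deligne 1973, Thm. 4.1 (existence of `ε` with (4.1.1)–(4.1.3), the normalisation (4.1.2)
being relative to the reciprocity isomorphisms of local class field theory, §2.3) and Thm. 6.5;
Langlands 1970 (unpublished); Tate, Corvallis 1979, (3.4.1); Bushnell–Henniart (2006), §29.4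
Theorem.  The tree's `nonempty_localEpsilonSystem F` is this statement with the normalisation
forgotten (`nonempty_localEpsilonSystem_of_isCanonical`).
[cite: Deligne1973Constantes, Thm. 4.1 and Thm. 6.5] -/
def nonempty_localEpsilonSystem_isCanonical (F : Type) [Field F] [ValuativeRel F]
    [TopologicalSpace F] [IsNonarchimedeanLocalField F] : Prop :=
  ∃ 𝓔 : LocalEpsilonSystem F, ∀ (E : Type) [Field E] [ValuativeRel E] [TopologicalSpace E]
    [IsNonarchimedeanLocalField E] [Algebra F E] [FiniteDimensional F E], (𝓔.artin E).IsCanonical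

variable {F : Type} [Field F] [ValuativeRel F] [TopologicalSpace F] [IsNonarchimedeanLocalField F]

/-- The canonically normalised existence theorem implies the tree's `nonempty_localEpsilonSystem F`
(Deligne 1973, Thm. 4.1, with the normalisation forgotten): project the witness. [folklore] -/
theorem nonempty_localEpsilonSystem_of_isCanonical (h : nonempty_localEpsilonSystem_isCanonical F) :
    nonempty_localEpsilonSystem F :=
  h.elim fun 𝓔 _ ↦ ⟨𝓔⟩

/-- In particular the witness is normalised against THE Artin map of `F` itself: take `E := F`
(with `Algebra.id F` and `F` finite-dimensional over itself). [folklore] -/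
theorem exists_isCanonical_artin_self (h : nonempty_localEpsilonSystem_isCanonical F) :
    ∃ 𝓔 : LocalEpsilonSystem F, (𝓔.artin F).IsCanonical :=
  h.elim fun 𝓔 h𝓔 ↦ ⟨𝓔, h𝓔 F⟩

end Literature.NumberTheory.Automorphic
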